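import Mathlib
import Literature.Computability.Complexity.CliqueTestGraphs
import Summits.PneNP.PneNP.Theorems.ConvexRankGatesConvexGateBlindBlocks
import Summits.PneNP.PneNP.Theorems.ConvexRankGatesConvexGateBlindRankForm
import Summits.PneNP.PneNP.Theorems.ConvexRankGatesConvexGateBlindCliqueDistanceSdp

/-!
# PneNP / ConvexRankGates — `ConvexGateBlind`: the canonical form of the crux

Helpers (`--supports stmt-PneNP-10680`). The crux of route ConvexRankGates, restated — with both directions
kernel-checked — as an ε-sensitive CONE-RANK statement about ONE explicit matrix family, the one-sided
clique distances `D[Q,u] = #(E(Q) ∖ u)` (`Q` the `⌈m^δ⌉₊`-sets, `u` the `⌈m^δ⌉₊`-clique-free graphs of `K_m`):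

  `ConvexGateBlind ↔ ∃ δ ∈ (0,1/2), ∀ c, ∀ᶠ m, ∀ ε > 0, ∀ q r, q + r ≤ m^c →` there are NO
  `H_u ⪰ 0` (`u` clique-free), `Y_Q ⪰ 0` (`q × q`), `U, V ≥ 0` (`r` terms) with
  `D[Q,u] - ε = tr(H_u Y_Q) + ∑_l U_{u,l} V_{l,Q}` for all `Q, u`            (`convexGateBlind_iff_cliqueDistConeRankHard`).

Ingredients: collapse to one gate (`convexGateBlind_iff_oneGate`), wiring (`oneGateHard_iff_dataHard`), gate ⇒
cone factorisation of `D - εJ` (`convGate_cliqueDist_coneFactorisation`), and cone factorisation ⇒ gate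
(`exists_convData_of_factorisation` with the certificate system `w_u = 1_{E∖u}`, `θ_u = ε`; `tr(H Z) ≥ 0` for PSD
`H, Z`); sizes are polynomially related (`q + (p + 2#E + 3)` resp. `O(#E + q² + r)`), absorbed by `∀ c`. The LP slice
(`H = 0`, `q = 0`) is `cliqueDist_rankHard_iff_lpDataHard` (`…CliqueDistanceConverse.lean`) = Hrubeš's
`min_ε rk_+(M_+(f) - εJ)` for `f = CLIQUE` (Open Problems 3–4 of `Hrubes2020`). [folklore assembly]
-/

namespace Summit.PneNP.PneNP.Theorems

open Matrix Finset Literature.Computability.Complexity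

/-- **Data form ↔ canonical cone-rank form** (for a fixed `δ`). "For every `c`, eventually no CONV data with
`p + q ≤ m^c` compute `CLIQUE(m, ⌈m^δ⌉₊)`" iff "for every `c`, eventually, for every `ε > 0`, `D - εJ` has no
`(PSD_q ⊕ ℝ^r_{≥0})`-factorisation with `q + r ≤ m^c`". [folklore assembly] -/
theorem convDataHard_iff_cliqueDistConeRankHard (δ : ℝ) :
    (∀ c : ℕ, ∀ᶠ m : ℕ in Filter.atTop, ∀ (p q : ℕ), p + q ≤ m ^ c →
      ∀ (A : Fin p → Matrix (Fin q) (Fin q) ℝ) (b : Fin p → ℝ) (B : Fin p → (⊤ : SimpleGraph (Fin m)).edgeSet → ℝ), (∀ i e, 0 ≤ B i e) →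
        ¬ ∀ x : (⊤ : SimpleGraph (Fin m)).edgeSet → Bool, cliqueFn m ⌈(m : ℝ) ^ δ⌉₊ x = true ↔
          ∃ Y : Matrix (Fin q) (Fin q) ℝ, Y.PosSemidef ∧
            ∀ i, (A i * Y).trace ≤ b i + ∑ e, B i e * (if x e then (1 : ℝ) else 0)) ↔
    (∀ c : ℕ, ∀ᶠ m : ℕ in Filter.atTop, ∀ ε : ℝ, 0 < ε → ∀ (q r : ℕ), q + r ≤ m ^ c →
      ∀ (H : ((⊤ : SimpleGraph (Fin m)).edgeSet → Bool) → Matrix (Fin q) (Fin q) ℝ) (Y : Finset (Fin m) → Matrix (Fin q) (Fin q) ℝ)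
        (U : ((⊤ : SimpleGraph (Fin m)).edgeSet → Bool) → Fin r → ℝ) (V : Fin r → Finset (Fin m) → ℝ),
        (∀ u, cliqueFn m ⌈(m : ℝ) ^ δ⌉₊ u = false → (H u).PosSemidef) →
        (∀ Q : Finset (Fin m), Q.card = ⌈(m : ℝ) ^ δ⌉₊ → (Y Q).PosSemidef) →
        (∀ u l, 0 ≤ U u l) → (∀ l Q, 0 ≤ V l Q) →
        ¬ ∀ (Q : Finset (Fin m)) (u : (⊤ : SimpleGraph (Fin m)).edgeSet → Bool), Q.card = ⌈(m : ℝ) ^ δ⌉₊ → cliqueFn m ⌈(m : ℝ) ^ δ⌉₊ u = false →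
            (∑ e, if cliqueVec Q e = true ∧ u e = false then (1 : ℝ) else 0) - ε =
              (H u * Y Q).trace + ∑ l, U u l * V l Q) := by
  classical
  constructor
  · -- a small cone factorisation of `D - εJ` would give small CONV data
    intro hhard c
    filter_upwards [hhard (2 * c + 3), Filter.eventually_ge_atTop 12] with m hm hm12
    intro ε hε q r hqr H Y U V hH hY hU hV hfact
    set k := ⌈(m : ℝ) ^ δ⌉₊ with hk
    -- the certificate system `w_u = 1_{E∖u}`, `θ_u = ε`
    have hind : ∀ (Q : Finset (Fin m)) (u : (⊤ : SimpleGraph (Fin m)).edgeSet → Bool),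
        ∑ e, (if u e then (0 : ℝ) else 1) * (if cliqueVec Q e then (1 : ℝ) else 0) =
          ∑ e, if cliqueVec Q e = true ∧ u e = false then (1 : ℝ) else 0 := fun Q u =>
      Finset.sum_congr rfl fun e _ => by cases u e <;> cases cliqueVec Q e <;> simp
    obtain ⟨R, instR, hcardR, A, b, B, hB, hiff⟩ := exists_convData_of_factorisation (k := k)
      (fun u e => if u e then (0 : ℝ) else 1) (fun _ => ε) H U Y (fun Q l => V l Q)
      (fun u _ e => by split_ifs <;> norm_num)
      (fun u _ => by
        have : ∑ e, (if u e then (0 : ℝ) else 1) * (if u e then (1 : ℝ) else 0) = 0 :=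
          Finset.sum_eq_zero fun e _ => by cases u e <;> simp
        rw [this]; exact hε)
      (fun u hu Z hZ => trace_mul_nonneg_of_posSemidef (hH u hu) hZ) (fun u _ l => hU u l) hY (fun Q _ l => hV l Q)
      (fun Q u hQ hu => by rw [hind]; exact hfact Q u hQ hu)
    obtain ⟨A', b', B', hB', hiff'⟩ := conv_feasible_reindex A b B
    have hn : Fintype.card (⊤ : SimpleGraph (Fin m)).edgeSet ≤ m ^ 2 := card_edgeSet_top_le m
    have hm1 : 1 ≤ m := by omega
    have hq : q ≤ m ^ c := by omega
    have hr : r ≤ m ^ c := by omega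
    have h2 : m ^ 2 ≤ m ^ (2 * c + 2) := Nat.pow_le_pow_right hm1 (by omega)
    have hc' : m ^ c ≤ m ^ (2 * c + 2) := Nat.pow_le_pow_right hm1 (by omega)
    have h2c : m ^ (2 * c) ≤ m ^ (2 * c + 2) := Nat.pow_le_pow_right hm1 (by omega)
    have h1 : 1 ≤ m ^ (2 * c + 2) := Nat.one_le_pow _ _ (by omega)
    have hqq : q * q ≤ m ^ (2 * c) := by
      calc q * q ≤ m ^ c * m ^ c := Nat.mul_le_mul hq hq
        _ = m ^ (2 * c) := by rw [← pow_add]; ring_nf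
    have h12 : 12 * m ^ (2 * c + 2) ≤ m ^ (2 * c + 3) := by
      calc 12 * m ^ (2 * c + 2) = m ^ (2 * c + 2) * 12 := Nat.mul_comm _ _
        _ ≤ m ^ (2 * c + 2) * m := Nat.mul_le_mul_left _ hm12
        _ = m ^ (2 * c + 3) := (pow_succ m (2 * c + 2)).symm
    have hj : Fintype.card (Fin q ⊕ ((⊤ : SimpleGraph (Fin m)).edgeSet ⊕ Fin r)) = q + (Fintype.card (⊤ : SimpleGraph (Fin m)).edgeSet + r) := by
      simp only [Fintype.card_sum, Fintype.card_fin]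
    have hsize : Fintype.card R + Fintype.card (Fin q ⊕ ((⊤ : SimpleGraph (Fin m)).edgeSet ⊕ Fin r)) ≤ m ^ (2 * c + 3) := by
      rw [hj]
      omega
    refine hm _ _ hsize A' b' B' (fun i e => by rw [hB']; exact hB _ e) fun x => ?_
    rw [hiff x]
    exact hiff' x
  · -- small CONV data would give a small cone factorisation of `D - εJ`
    intro hhard c
    filter_upwards [hhard (c + 3), Filter.eventually_ge_atTop 4] with m hm hm4
    intro p q hpq A b B hB hiff
    obtain ⟨ε, hε, H', Y', U, V, hH', hY', hU, hV, hfact⟩ := convGate_cliqueDist_coneFactorisation A b B hB hiff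
    set eL := Fintype.equivFin ((Fin p ⊕ Unit) ⊕ (((⊤ : SimpleGraph (Fin m)).edgeSet ⊕ (⊤ : SimpleGraph (Fin m)).edgeSet) ⊕ Unit)) with heL
    have hcard : q + Fintype.card ((Fin p ⊕ Unit) ⊕ (((⊤ : SimpleGraph (Fin m)).edgeSet ⊕ (⊤ : SimpleGraph (Fin m)).edgeSet) ⊕ Unit)) ≤ m ^ (c + 3) := by
      have hn : Fintype.card (⊤ : SimpleGraph (Fin m)).edgeSet ≤ m ^ 2 := card_edgeSet_top_le m
      simp only [Fintype.card_sum, Fintype.card_fin, Fintype.card_unique]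
      have h1 : 1 ≤ m := by omega
      have e1 : m ^ c ≤ m ^ (c + 2) := Nat.pow_le_pow_right h1 (by omega)
      have e2 : m ^ 2 ≤ m ^ (c + 2) := Nat.pow_le_pow_right h1 (by omega)
      have e3 : 1 ≤ m ^ (c + 2) := Nat.one_le_pow _ _ h1
      have e4 : 4 * m ^ (c + 2) ≤ m ^ (c + 3) := by
        calc 4 * m ^ (c + 2) = m ^ (c + 2) * 4 := Nat.mul_comm _ _
          _ ≤ m ^ (c + 2) * m := Nat.mul_le_mul_left _ hm4
          _ = m ^ (c + 3) := (pow_succ m (c + 2)).symm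
      have e5 : m ≤ m ^ (c + 2) := by
        calc m = m ^ 1 := (pow_one m).symm
          _ ≤ m ^ (c + 2) := Nat.pow_le_pow_right h1 (by omega)
      omega
    refine hm ε hε q _ hcard H' Y' (fun u i => U u (eL.symm i)) (fun i Q => V (eL.symm i) Q) hH' hY'
      (fun u i => hU u _) (fun i Q => hV _ Q) fun Q u hQ hu => ?_
    rw [hfact Q u hQ hu, ← Equiv.sum_comp eL.symm (fun l => U u l * V l Q)]

/-- **`ConvexGateBlind` in canonical form.** The crux holds iff for some `δ ∈ (0, 1/2)` and every `c`, eventually,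
for every `ε > 0` the shifted one-sided clique-distance matrix `D - εJ` of `CLIQUE(m, ⌈m^δ⌉₊)` admits no
factorisation `D[Q,u] - ε = tr(H_u Y_Q) + ∑_{l<r} U_{u,l} V_{l,Q}` with `H_u, Y_Q ⪰ 0` (`q × q`), `U, V ≥ 0` and
`q + r ≤ m^c`. [folklore assembly] -/
theorem convexGateBlind_iff_cliqueDistConeRankHard :
    Summit.PneNP.PneNP.Theses.ConvexRankGates.ConvexGateBlind ↔
    (∃ δ : ℝ, 0 < δ ∧ δ < 1 / 2 ∧ ∀ c : ℕ, ∀ᶠ m : ℕ in Filter.atTop, ∀ ε : ℝ, 0 < ε → ∀ (q r : ℕ), q + r ≤ m ^ c →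
      ∀ (H : ((⊤ : SimpleGraph (Fin m)).edgeSet → Bool) → Matrix (Fin q) (Fin q) ℝ) (Y : Finset (Fin m) → Matrix (Fin q) (Fin q) ℝ)
        (U : ((⊤ : SimpleGraph (Fin m)).edgeSet → Bool) → Fin r → ℝ) (V : Fin r → Finset (Fin m) → ℝ),
        (∀ u, cliqueFn m ⌈(m : ℝ) ^ δ⌉₊ u = false → (H u).PosSemidef) →
        (∀ Q : Finset (Fin m), Q.card = ⌈(m : ℝ) ^ δ⌉₊ → (Y Q).PosSemidef) →
        (∀ u l, 0 ≤ U u l) → (∀ l Q, 0 ≤ V l Q) →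
        ¬ ∀ (Q : Finset (Fin m)) (u : (⊤ : SimpleGraph (Fin m)).edgeSet → Bool), Q.card = ⌈(m : ℝ) ^ δ⌉₊ → cliqueFn m ⌈(m : ℝ) ^ δ⌉₊ u = false →
            (∑ e, if cliqueVec Q e = true ∧ u e = false then (1 : ℝ) else 0) - ε =
              (H u * Y Q).trace + ∑ l, U u l * V l Q) := by
  rw [convexGateBlind_iff_oneGate]
  refine exists_congr fun δ => and_congr_right fun _ => and_congr_right fun _ => ?_
  rw [← convDataHard_iff_cliqueDistConeRankHard δ]
  refine forall_congr' fun c => Filter.eventually_congr (Filter.Eventually.of_forall fun m => ?_)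
  exact oneGateHard_iff_dataHard m ⌈(m : ℝ) ^ δ⌉₊ (m ^ c)

end Summit.PneNP.PneNP.Theorems
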